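import Summits.CriticalPhenomena.CardyFormulaZ2.Theses.DyadicBetaRigidity
import Summits.CriticalPhenomena.CardyFormulaZ2.Theses.CardyExpCovariance
import Summits.CriticalPhenomena.CardyFormulaZ2.Theorems.DyadicBetaRigidityDyadicLatticeBetaLawStubSubseqSandwich
import Summits.CriticalPhenomena.CardyFormulaZ2.Theorems.DyadicBetaRigidityDyadicLatticeBetaLawStubRectSubseqLimits
import Summits.CriticalPhenomena.CardyFormulaZ2.Theorems.DyadicBetaRigidityDyadicLatticeBetaLawStubClusterLaw
import Summits.CriticalPhenomena.CardyFormulaZ2.Theorems.DyadicBetaRigidityDyadicLatticeBetaLawStubS1OfCrux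
import Literature.Probability.RandomPlanarGeometry.CardyFunctionIncBeta

/-!
# Cardy's formula on `ℤ²` splits exactly into equicontinuous dyadic comparison and sequential rigidity

Crux `DyadicLatticeBetaLaw` (stmt-CriticalPhenomena-18183, route `DyadicBetaRigidity` of
`CardyFormulaZ2`), line `Sketch` (idea `equimodular-comparison`). With the line's landed stubs
S2 `Stubs.stub_subseqSandwich`, S5a `Stubs.stub_rectSubseqLimits`, S5b
`Stubs.stub_clusterLawOfComparison` and the support stub `Stubs.stub_equicontinuousComparison_of_crux`,
this file records, at Theorems level, the composition of the line and its summit-level meaning: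

* `crux_of_comparison_of_rigiditySeq` — S1 (equicontinuous equimodular comparison of lattice
  polygons along the dyadic ladders) and `CardyExpCovariance.CardyRigiditySeq`
  (stmt-CriticalPhenomena-4680) imply the crux `DyadicLatticeBetaLaw` (every subsequence of a dyadic
  ladder has a convergent refinement by compactness; S5b passes a continuous self-dual law through
  its limit; S2 upgrades to all conformal rectangles; rigidity identifies the law with
  `cardyFunction = I_{2/3}`; `tendsto_of_subseq_tendsto`);
* `cardyRigidity_of_rigiditySeq` — sequential rigidity implies the route's `CardyRigidity`;
* `stub_cardyFormulaZ2_iff_comparison_and_rigiditySeq` (registered support stub of the crux item) —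
  **`CardyFormulaZ2 ↔ S1 ∧ CardyRigiditySeq`**: Cardy's formula for bond percolation on `ℤ²` is
  EQUIVALENT to the conjunction of a purely comparative statement about lattice polygons along
  dyadic meshes (no limit object, no value) and the sequential rigidity of the exponent
  (`→`: `S → crux → S1` by uniform continuity of `I_{2/3}`, and `S → rigidity` by uniqueness of
  limits on the box family `stub_rectangleFamily`; `←`: the composition, then the route's proved
  glue `DyadicBetaSuffices_proof` and deciding theorem `DyadicBetaRigidity.closes`).

References: J. Cardy, J. Phys. A 25 (1992) L201; S. Smirnov, C. R. Acad. Sci. Paris 333 (2001);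
B. Bollobás, O. Riordan, *Percolation* (2006), Ch. 7; O. Schramm, Proc. ICM 2006, Problem 2.11.
-/

noncomputable section

open MeasureTheory Filter Set Metric Topology
open UpperHalfPlane (upperHalfPlaneSet)
open Literature.Probability.RandomPlanarGeometry Literature.Probability.LatticeModels
open Literature.Probability.Percolation hiding cardyFunction
open Summit.CriticalPhenomena.CardyFormulaZ2.Theses

namespace Summit.CriticalPhenomena.CardyFormulaZ2.Cruxes.DyadicLatticeBetaLaw.Stubs

/-! ### Glue lemmas -/

/-- **Cardy's function is the beta law of exponent `2/3`** on `(0,1)` (tree theorem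
`cardyFunction_eq_incBeta13_div_holds`). [cite: Cardy1992, eq. (8)] -/
theorem cardyFunction_eq_betaLaw_two_thirds {η : ℝ} (hη : η ∈ Set.Ioo (0 : ℝ) 1) :
    cardyFunction η =
      (∫ s in (0 : ℝ)..η, (s * (1 - s)) ^ (-(2 / 3 : ℝ))) /
        ∫ s in (0 : ℝ)..1, (s * (1 - s)) ^ (-(2 / 3 : ℝ)) :=
  cardyFunction_eq_incBeta13_div_holds η ⟨hη.1.le, hη.2.le⟩

/-- The meshes `1/2^(m n)` of a strictly increasing `m : ℕ → ℕ` tend to `0` from the right.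
[folklore] -/
theorem tendsto_mesh_of_strictMono' {m : ℕ → ℕ} (hm : StrictMono m) :
    Tendsto (fun n : ℕ => (1 : ℝ) / 2 ^ (m n)) atTop (𝓝[>] (0 : ℝ)) := by
  rw [tendsto_nhdsWithin_iff]
  refine ⟨?_, Eventually.of_forall fun n => Set.mem_Ioi.2 (by positivity)⟩
  have h1 : Tendsto (fun n : ℕ => (2 : ℝ) ^ (m n)) atTop atTop :=
    (tendsto_pow_atTop_atTop_of_one_lt one_lt_two).comp hm.tendsto_atTop
  exact tendsto_const_nhds.div_atTop h1

/-- Dyadic meshes `h / 2^k` tend to `0` from the right. [folklore] -/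
theorem tendsto_dyadicMesh' {h : ℝ} (hh : 0 < h) :
    Tendsto (fun k : ℕ => h / 2 ^ k) atTop (𝓝[>] (0 : ℝ)) := by
  rw [tendsto_nhdsWithin_iff]
  refine ⟨?_, Eventually.of_forall fun k => Set.mem_Ioi.2 (div_pos hh (pow_pos two_pos k))⟩
  exact tendsto_const_nhds.div_atTop (tendsto_pow_atTop_atTop_of_one_lt one_lt_two)

/-- From two one-sided eventual bounds with equal levels: convergence. [folklore] -/
theorem tendsto_of_sandwich' {P : ℕ → ℝ} {L L' : ℝ} (hLL' : L' = L)
    (h : ∀ e : ℝ, 0 < e → (∀ᶠ n : ℕ in atTop, L - e < P n) ∧ (∀ᶠ n : ℕ in atTop, P n < L' + e)) :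
    Tendsto P atTop (𝓝 L) := by
  subst hLL'
  rw [Metric.tendsto_nhds]
  intro e he
  obtain ⟨h1, h2⟩ := h e he
  filter_upwards [h1, h2] with n hn1 hn2
  rw [Real.dist_eq, abs_sub_lt_iff]
  constructor <;> linarith

/-! ### The composition of line `Sketch` -/

/-- **S1 and sequential rigidity imply the crux.** Equicontinuous equimodular comparison of lattice
polygons along the dyadic ladders (stub S1 of line `Sketch`, stated inline) together with
`CardyExpCovariance.CardyRigiditySeq` (stmt-CriticalPhenomena-4680) give `DyadicLatticeBetaLaw`
with `a = 2/3`: a subsequence of a dyadic ladder has a strictly increasing convergent refinement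
(compactness of `[0,1]`); S5b (landed, fed by S1 and the landed S5a) passes a continuous self-dual
law `f` through its limit; S2 (landed) upgrades to convergence of every conformal rectangle along
`1/2^(κ (σ n))`; rigidity gives `f = cardyFunction = I_{2/3}` on `(0,1)`; `tendsto_of_subseq_tendsto`.
[cite: BollobasRiordan2006, Ch. 7 §7.1] -/
theorem crux_of_comparison_of_rigiditySeq
    (hS1 : ∀ ε : ℝ, 0 < ε → ∀ η ∈ Set.Ioo (0 : ℝ) 1, ∃ θ : ℝ, 0 < θ ∧
      ∀ h h' : ℝ, 0 < h → 0 < h' → ∀ R R' : ConformalRectangle,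
        (∃ S : Finset (ℂ × ℂ), (∀ p ∈ S, ∃ u v : Site 2, (zdGraph 2).Adj u v ∧
            p.1 = meshPoint h u ∧ p.2 = meshPoint h v) ∧
            frontier R.carrier ⊆ ⋃ p ∈ S, segment ℝ p.1 p.2) →
        (∃ S : Finset (ℂ × ℂ), (∀ p ∈ S, ∃ u v : Site 2, (zdGraph 2).Adj u v ∧
            p.1 = meshPoint h' u ∧ p.2 = meshPoint h' v) ∧
            frontier R'.carrier ⊆ ⋃ p ∈ S, segment ℝ p.1 p.2) →
        ∀ (φ : ConformalEquiv upperHalfPlaneSet R.carrier) (x : Fin 4 → ℝ)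
          (φ' : ConformalEquiv upperHalfPlaneSet R'.carrier) (x' : Fin 4 → ℝ),
          R.IsUniformizing φ x → R'.IsUniformizing φ' x' →
          |crossRatio x - η| < θ → |crossRatio x' - η| < θ →
          ∀ᶠ k : ℕ in atTop,
            |bondDomainCrossingProb R (h / 2 ^ k) - bondDomainCrossingProb R' (h' / 2 ^ k)| < ε)
    (hRig : CardyExpCovariance.CardyRigiditySeq) :
    DyadicBetaRigidity.DyadicLatticeBetaLaw := by
  refine ⟨2 / 3, ⟨by norm_num, by norm_num⟩, ?_⟩
  intro h hh R hR φ x hφ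
  have hη : crossRatio x ∈ Set.Ioo (0 : ℝ) 1 :=
    ConformalRectangle.crossRatio_mem_Ioo_of_isUniformizing hφ
  rw [← cardyFunction_eq_betaLaw_two_thirds hη]
  refine tendsto_of_subseq_tendsto fun ns hns => ?_
  -- a strictly increasing refinement of `ns`
  obtain ⟨ψ, -, hnsψ⟩ := strictMono_subseq_of_tendsto_atTop hns
  -- a convergent further subsequence (compactness of `[0,1]`)
  obtain ⟨p, -, ψ', hψ', hp⟩ := isCompact_Icc.tendsto_subseq
    (x := fun n => bondDomainCrossingProb R (h / 2 ^ (ns (ψ n))))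
    (fun n => bondDomainCrossingProb_mem_Icc R _)
  set κ : ℕ → ℕ := fun n => ns (ψ (ψ' n)) with hκ
  have hκm : StrictMono κ := hnsψ.comp hψ'
  have hpκ : Tendsto (fun n => bondDomainCrossingProb R (h / 2 ^ (κ n))) atTop (𝓝 p) := hp
  -- S5b (with S1, S5a): a continuous self-dual law `f` through the cluster point `p`
  obtain ⟨σ, hσ, f, hfc, hfs, hfp, hlaw⟩ :=
    stub_clusterLawOfComparison hS1 stub_rectSubseqLimits h hh R hR φ x hφ κ hκm p hpκ
  have hκσ : StrictMono fun n => κ (σ n) := hκm.comp hσ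
  -- S2: every conformal rectangle converges along `1/2^(κ (σ n))` to `f`
  have hall : ∀ (R' : ConformalRectangle) (φ' : ConformalEquiv upperHalfPlaneSet R'.carrier)
      (x' : Fin 4 → ℝ), R'.IsUniformizing φ' x' →
      Tendsto (fun n => bondDomainCrossingProb R' (1 / 2 ^ (κ (σ n)))) atTop
        (𝓝 (f (crossRatio x'))) := by
    intro R' φ' x' hφ'
    have hη' := ConformalRectangle.crossRatio_mem_Ioo_of_isUniformizing hφ'
    have hsymm : 1 - f (1 - crossRatio x') = f (crossRatio x') := by
      rw [hfs _ hη']; ring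
    exact tendsto_of_sandwich' hsymm
      (stub_subseqSandwich (fun n => κ (σ n)) f hκσ hfc hlaw R' φ' x' hφ')
  -- rigidity identifies `f` with Cardy's function on `(0,1)`
  have hEqOn : Set.EqOn f cardyFunction (Set.Ioo 0 1) :=
    hRig (fun n => 1 / 2 ^ (κ (σ n))) f (tendsto_mesh_of_strictMono' hκσ) hall
  refine ⟨fun n => ψ (ψ' (σ n)), ?_⟩
  have hlim : Tendsto (fun n => bondDomainCrossingProb R (h / 2 ^ (κ (σ n)))) atTop (𝓝 p) :=
    hpκ.comp hσ.tendsto_atTop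
  rw [← hfp, hEqOn hη] at hlim
  exact hlim

/-! ### Sequential rigidity and the route's rigidity item -/

/-- Sequential Cardy rigidity (`CardyExpCovariance.CardyRigiditySeq`, stmt-4680) implies the
full-filter rigidity `DyadicBetaRigidity.CardyRigidity` (stmt-0746): restrict the full limits to
the meshes `1/2^n`. [cite: Smirnov2001, Thm 2] -/
theorem cardyRigidity_of_rigiditySeq (hRig : CardyExpCovariance.CardyRigiditySeq) :
    DyadicBetaRigidity.CardyRigidity := by
  intro f hf
  refine hRig (fun n : ℕ => (1 : ℝ) / 2 ^ n) f ?_ fun R φ x hφ => (hf R φ x hφ).comp ?_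
  · simpa using tendsto_mesh_of_strictMono' (m := id) strictMono_id
  · simpa using tendsto_mesh_of_strictMono' (m := id) strictMono_id

/-- `CardyFormulaZ2` implies sequential Cardy rigidity: a law `f` reached by all conformal
rectangles along some `u_k → 0⁺` agrees with Cardy's function at every modulus `η ∈ (0,1)`, since
some corner-marked box has modulus `η` (`stub_rectangleFamily`) and its crossing probabilities
along `u_k` converge both to `f(η)` and to `F(η)`. [cite: Smirnov2001, Thm 1] -/
theorem rigiditySeq_of_cardyFormulaZ2 (hS : _root_.CardyFormulaZ2) :
    CardyExpCovariance.CardyRigiditySeq := by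
  intro u f hu hf η hη
  obtain ⟨Q, -, -, -, -, -, hsurj, -⟩ :=
    Summit.CriticalPhenomena.CardyFormulaZ2.Cruxes.SimilarityUpgrade.Stubs.stub_rectangleFamily
  obtain ⟨w, -, hw⟩ := hsurj η hη
  obtain ⟨φ, x, hφ⟩ := MarkedDomain.exists_isUniformizing_holds (Q w)
  have h1 : Tendsto (fun k => bondDomainCrossingProb (Q w) (u k)) atTop (𝓝 (f η)) := by
    rw [← hw φ x hφ]; exact hf (Q w) φ x hφ
  have h2 : Tendsto (fun k => bondDomainCrossingProb (Q w) (u k)) atTop (𝓝 (cardyFunction η)) := by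
    rw [← hw φ x hφ]; exact (hS (Q w) φ x hφ).comp hu
  exact tendsto_nhds_unique h1 h2

/-- `CardyFormulaZ2` implies the crux `DyadicLatticeBetaLaw` (`a = 2/3`: `cardyFunction = I_{2/3}` on
`[0,1]`; dyadic meshes `h/2^k → 0⁺`; the lattice hypothesis is dropped). [cite: Cardy1992, eq. (8)] -/
theorem crux_of_cardyFormulaZ2 (hS : _root_.CardyFormulaZ2) : DyadicBetaRigidity.DyadicLatticeBetaLaw := by
  refine ⟨2 / 3, ⟨by norm_num, by norm_num⟩, ?_⟩
  intro h hh R _ φ x hφ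
  have hη : crossRatio x ∈ Set.Ioo (0 : ℝ) 1 :=
    ConformalRectangle.crossRatio_mem_Ioo_of_isUniformizing hφ
  have hT := (hS R φ x hφ).comp (tendsto_dyadicMesh' hh)
  rw [cardyFunction_eq_betaLaw_two_thirds hη] at hT
  exact hT

/-! ### The summit conjunct splits exactly -/

/-- **`CardyFormulaZ2 ↔ S1 ∧ CardyRigiditySeq`** (registered support stub
`stub_cardyFormulaZ2_iff_comparison_and_rigiditySeq` of crux stmt-CriticalPhenomena-18183, line
`Sketch`). Cardy's formula for critical bond percolation on `ℤ²` is equivalent to the conjunction of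
(S1) the equicontinuous equimodular comparison of lattice polygons along the dyadic ladders — a
purely comparative statement: no limit object, no value — and sequential Cardy rigidity
(stmt-CriticalPhenomena-4680). `→`: `S → crux → S1` (uniform continuity of `I_{2/3}`,
`stub_equicontinuousComparison_of_crux`) and `rigiditySeq_of_cardyFormulaZ2`; `←`: the composition
`crux_of_comparison_of_rigiditySeq`, rigidity `cardyRigidity_of_rigiditySeq`, the route's proved glue
`DyadicBetaSuffices_proof` and deciding theorem `DyadicBetaRigidity.closes`.
[cite: Schramm2007ICM, Problem 2.11] -/
theorem stub_cardyFormulaZ2_iff_comparison_and_rigiditySeq :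
    _root_.CardyFormulaZ2 ↔
      ((∀ ε : ℝ, 0 < ε → ∀ η ∈ Set.Ioo (0 : ℝ) 1, ∃ θ : ℝ, 0 < θ ∧
        ∀ h h' : ℝ, 0 < h → 0 < h' → ∀ R R' : ConformalRectangle,
          (∃ S : Finset (ℂ × ℂ), (∀ p ∈ S, ∃ u v : Site 2, (zdGraph 2).Adj u v ∧
              p.1 = meshPoint h u ∧ p.2 = meshPoint h v) ∧
              frontier R.carrier ⊆ ⋃ p ∈ S, segment ℝ p.1 p.2) →
          (∃ S : Finset (ℂ × ℂ), (∀ p ∈ S, ∃ u v : Site 2, (zdGraph 2).Adj u v ∧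
              p.1 = meshPoint h' u ∧ p.2 = meshPoint h' v) ∧
              frontier R'.carrier ⊆ ⋃ p ∈ S, segment ℝ p.1 p.2) →
          ∀ (φ : ConformalEquiv upperHalfPlaneSet R.carrier) (x : Fin 4 → ℝ)
            (φ' : ConformalEquiv upperHalfPlaneSet R'.carrier) (x' : Fin 4 → ℝ),
            R.IsUniformizing φ x → R'.IsUniformizing φ' x' →
            |crossRatio x - η| < θ → |crossRatio x' - η| < θ →
            ∀ᶠ k : ℕ in atTop,
              |bondDomainCrossingProb R (h / 2 ^ k) - bondDomainCrossingProb R' (h' / 2 ^ k)| < ε) ∧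
        Summit.CriticalPhenomena.CardyFormulaZ2.Theses.CardyExpCovariance.CardyRigiditySeq) := by
  constructor
  · intro hS
    exact ⟨stub_equicontinuousComparison_of_crux (crux_of_cardyFormulaZ2 hS),
      rigiditySeq_of_cardyFormulaZ2 hS⟩
  · rintro ⟨hS1, hRig⟩
    exact DyadicBetaRigidity.closes (crux_of_comparison_of_rigiditySeq hS1 hRig)
      (cardyRigidity_of_rigiditySeq hRig)
      Summit.CriticalPhenomena.CardyFormulaZ2.Theorems.DyadicBetaSuffices_proof

end Summit.CriticalPhenomena.CardyFormulaZ2.Cruxes.DyadicLatticeBetaLaw.Stubs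

end
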